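import Summits.BirchSwinnertonDyer.Rank1Residual.X11b.LocalTorsionTamagawa
import Literature.NumberTheory.EllipticCurves.PAdicHeightsProofs
import Literature.NumberTheory.EllipticCurves.PAdicHeightsTateValuationProofs
import HarnessLib

/-!
# Class X11b at `p = 3` (team N8/O2, cell `b2b-bsdres`): the local-torsion conjunct of the A′-locus at `3` decided by local data — `E(ℚ₃)[3] ≠ 0` iff `3` is SPLIT multiplicative and the Tate parameter is a CUBE (sub-target S4 · LOC3)

HONEST FRAMING (verbatim, cell `b2b-bsdres`, run/shared/lean/b2b/bsd-rank1-residual/): the goal of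
the cell is to DELETE the COMBINATION-SHAPED residual classes for ALL analytic-rank `≤ 1` curves
over `ℚ` — "full BSD formula for every rank `≤ 1` curve in class `C`" assembled STRICTLY from
published theorems — so that the rank-`≤ 1` remainder becomes exactly the CONSTRUCTION-SHAPED
classes, which are TYPED (missing-input Props), NOT attempted; this is not "finishing BSD".
Research route for class X11b at the prime `p = 3`; no claim beyond the stated class; nothing
booked; X11 ∧ `r = 1` at `p = 3` stays CONSTRUCTION-SHAPED (REFEREE R6.2). THEOREMS ONLY (no
definition, no named fact, no `sorry`). The one published input that is not yet a tree fact —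
Tate's `p`-adic uniformization of the `ℚ_p`-POINTS, Silverman *ATAEC* Thm. V.3.1(d) with Thm. V.5.3
(the tree's `TateParameterData` pins the parameter `q` by `j(q) = j(E)` but does not record the group
isomorphism `E(ℚ_p) ≅ ℚ_p^×/q^ℤ`) — enters as the explicit hypothesis `hT`, verbatim the body of the
Literature fact `Literature.NumberTheory.EllipticCurves.tateUniformization_points` proposed alongside
(`Literature/NumberTheory/EllipticCurves/TateCurvePointsUniformization.lean`, review-queued).

## What this file does

The typed missing input of X11 ∧ `r = 1` at `p = 3` (`X11Three.MissingInputAt W :=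
X11.AprimeShapeAt W 3`, `Typed/X11Three.lean`) carries the A′-locus `X11.AprimeLocusAt W 3`, whose
second conjunct is the local-torsion clause "`E(ℚ₃)[3] = 0`"
(`∀ P : (W.baseChange ℚ_[3]).toAffine.Point, 3 • P = 0 → P = 0`). What the tree already decides
at every multiplicative `p ≥ 3` (sibling `X11b/LocalTorsionMultiplicative.lean`,
`LocalTorsionTamagawa.lean`; nothing to re-prove at `3`): non-split ⇒ the clause holds
(`LocalTorsion.localTorsion_eq_zero_of_nonsplit`); `p ∤ v_p(Δ_min)` ⇒ it holds
(`…_of_not_dvd`); a non-zero `p`-torsion point forces split ∧ `p ∣ v_p(Δ_min) = c_p`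
(`LocalTorsion.split_and_dvd_of_localTorsion_ne_zero`); `p ∤ #Ẽ_ns(𝔽_p)`
(`LocalTorsion.not_dvd_reductionPointCount_of_mult`). What was NOT decided: the SPLIT case with
`3 ∣ v₃(Δ_min)`. This file closes it:

* hypothesis `hT` (ATAEC V.3.1(d) + V.5.3, PUBLISHED; the proposed fact `tateUniformization_points`
  read at `(W, 3)`): for every Tate parameter datum `D` of `E` at `3` (split multiplicative,
  `j(q) = j(E)`), an additive bijection `E(ℚ₃) → ℚ₃^×/q^ℤ`.
* `cube_eq_one_padic_three` — `μ₃(ℚ₃) = 1`: `x³ = 1` in `ℚ₃` forces `x = 1` (`(2x+1)² = −3` is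
  impossible since `‖−3‖₃ = 3⁻¹` is not the square of a value `3^{−v}`).
* `exists_torsion_three_quotient_iff` — in `ℚ₃^×/q^ℤ` (`‖q‖ < 1`) there is a non-trivial element
  killed by `3` iff `q` is a cube in `ℚ₃^×` (elementary: `u³ = q^k` with `3 ∣ k` gives a cube root
  of unity, `3 ∤ k` gives a cube root of `q`).
* **`three_torsion_ne_zero_iff_isCube`** — for `E/ℚ` split multiplicative at `3` with Tate datum
  `D`: `E(ℚ₃)[3] ≠ 0 ⟺ ∃ u, u³ = q_E`; **`aprimeTorsionClause_three_iff_not_isCube`** — the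
  A′-clause at `3` holds iff `q_E` is NOT a cube; `three_dvd_padicValInt_of_isCube` — a cube
  parameter forces `3 ∣ v₃(Δ_min)` (`ord₃ q_E = v₃(Δ_min)`, tree theorem
  `TateParameterData.valuation_q_eq_padicValInt_holds`), consistent with the sibling's necessary
  condition; `aprimeTorsionClause_three_of_mult_iff` — at a multiplicative `3`, the clause holds
  iff (`3` non-split) ∨ (`3` split and `q_E` is not a cube) (Tate's theorem
  `nonempty_tateParameterData_iff_holds` supplies the datum in the split case).
So the clause is DECIDED by local data at `3`: (split?, `v₃(Δ_min) mod 3`, the cube class of the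
unit part of `q_E`) — the last bit is `q_E·3^{−v} ≡ ±1 (mod 9)`, left to the instrument (census
ask I-9); window (x11b, `N < 10⁴`): exactly 2892a1, 3084c1, 5754f1 have `E(ℚ₃)[3] ≠ 0`.
CONDITIONAL on `hT` where stated; nothing booked; labels unchanged.

References: [SilvermanATAEC1994] Thm. V.3.1 (c),(d) (PDF pp. 394–395), Thm. V.5.3 (a),(b) (PDF
pp. 407–409), Remark IV.9.6; [SilvermanAEC2009] VII.3 Prop. 3.1, Thm. VII.6.1; [Castella2018Erratum]
Thm. A′ hypothesis "`E(ℚ_p)[p] = 0`" and Remark (pp. 1–2).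
-/

noncomputable section

open scoped Classical

open WeierstrassCurve Literature.NumberTheory.EllipticCurves
  Literature.NumberTheory.EllipticCurves.Rank1Residual
  Literature.NumberTheory.EllipticCurves.Rank1Residual.Typed

namespace Summit.BirchSwinnertonDyer.Rank1Residual.X11b.Three

/-! ### `ℚ₃` has no primitive cube root of unity -/

/-- **`μ₃(ℚ₃) = {1}`**: if `x³ = 1` in `ℚ₃` then `x = 1`. Otherwise `x² + x + 1 = 0`, so
`(2x + 1)² = −3`; but `‖−3‖₃ = 3⁻¹` while `‖2x+1‖₃² = 3^{−2v}` for an integer `v` — impossible.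
[folklore] -/
theorem cube_eq_one_padic_three [Fact (Nat.Prime 3)] (x : ℚ_[3]) (hx : x ^ 3 = 1) : x = 1 := by
  by_contra hne
  have hfac : (x - 1) * (x ^ 2 + x + 1) = 0 := by
    have : (x - 1) * (x ^ 2 + x + 1) = x ^ 3 - 1 := by ring
    rw [this, hx, sub_self]
  have hq : x ^ 2 + x + 1 = 0 := by
    rcases mul_eq_zero.mp hfac with h | h
    · exact absurd (sub_eq_zero.mp h) hne
    · exact h
  have hsq : (2 * x + 1) ^ 2 = -3 := by linear_combination 4 * hq
  have hy0 : (2 * x + 1 : ℚ_[3]) ≠ 0 := by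
    intro h0
    rw [h0] at hsq
    norm_num at hsq
  -- norms: `‖(2x+1)²‖ = ‖-3‖ = 3⁻¹`
  have hn3 : ‖(-3 : ℚ_[3])‖ = (3 : ℝ)⁻¹ := by
    rw [norm_neg]
    exact_mod_cast Padic.norm_p (p := 3)
  have hv : ‖(2 * x + 1 : ℚ_[3])‖ = (3 : ℝ) ^ (-(2 * x + 1).valuation) := by
    have h := Padic.norm_eq_zpow_neg_valuation hy0
    push_cast at h
    exact h
  have key : ((3 : ℝ) ^ (-(2 * x + 1).valuation)) ^ (2 : ℕ) = (3 : ℝ) ^ (-1 : ℤ) := by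
    rw [← hv, ← norm_pow, hsq, hn3, zpow_neg_one]
  rw [← zpow_natCast, ← zpow_mul] at key
  have hinj := zpow_right_injective₀ (by norm_num : (0 : ℝ) < 3) (by norm_num : (3 : ℝ) ≠ 1) key
  push_cast at hinj
  omega

/-! ### `3`-torsion in `ℚ₃^×/q^ℤ` -/

section Quotient

variable [Fact (Nat.Prime 3)]

/-- An element `q ∈ ℚ₃^×` with `‖q‖ < 1` has infinite order: `q^n = 1 ⟹ n = 0`. [folklore] -/
theorem zpow_eq_one_of_norm_lt_one {q : ℚ_[3]ˣ} (hq : ‖(q : ℚ_[3])‖ < 1) (n : ℤ)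
    (h : q ^ n = 1) : n = 0 := by
  have hpos : 0 < ‖(q : ℚ_[3])‖ := norm_pos_iff.mpr q.ne_zero
  have hval : ‖(q : ℚ_[3])‖ ^ n = 1 := by
    rw [← norm_zpow, ← Units.val_zpow_eq_zpow_val, h, Units.val_one, norm_one]
  rcases lt_trichotomy n 0 with hn | hn | hn
  · exact absurd hval (one_lt_zpow_of_neg₀ hpos hq hn).ne'
  · exact hn
  · exact absurd hval (zpow_lt_one₀ hpos hq hn).ne

/-- **`3`-torsion in `ℚ₃^×/q^ℤ` (`‖q‖ < 1`) is non-trivial iff `q` is a cube in `ℚ₃^×`.** (⇐) the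
class of a cube root `u` of `q` is killed by `3` and is non-trivial (`u ∈ q^ℤ` would give
`q^{3k−1} = 1`). (⇒) a non-trivial class `[u]` with `u³ = q^k`: if `3 ∣ k` then `u·q^{−k/3}` is a
cube root of unity, hence `1` (`cube_eq_one_padic_three`), so `[u]` is trivial; if `k ≡ 1, 2
(mod 3)` then `u·q^{−(k−1)/3}`, resp. `u²·q^{−(2k−1)/3}`, is a cube root of `q`. [folklore] -/
theorem exists_torsion_three_quotient_iff {q : ℚ_[3]ˣ} (hq : ‖(q : ℚ_[3])‖ < 1) :
    (∃ x : ℚ_[3]ˣ ⧸ Subgroup.zpowers q, x ≠ 1 ∧ x ^ 3 = 1) ↔ ∃ u : ℚ_[3]ˣ, u ^ 3 = q := by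
  constructor
  · rintro ⟨x, hx1, hx3⟩
    obtain ⟨u, rfl⟩ := QuotientGroup.mk_surjective x
    have hmem : u ^ 3 ∈ Subgroup.zpowers q := by
      rw [← QuotientGroup.eq_one_iff, QuotientGroup.mk_pow]; exact hx3
    obtain ⟨k, hk⟩ := Subgroup.mem_zpowers_iff.mp hmem
    have hnot : u ∉ Subgroup.zpowers q := fun h ↦ hx1 ((QuotientGroup.eq_one_iff u).mpr h)
    -- `(q ^ a) ^ 3 = q ^ (a * 3)` and `(u ^ 2) ^ 3 = (q ^ k) ^ 2`
    have e3 : ∀ a : ℤ, (q ^ a) ^ (3 : ℕ) = q ^ (a * 3) := fun a ↦ by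
      rw [← zpow_natCast (q ^ a) 3, ← zpow_mul]; norm_num
    have h3 : k % 3 = 0 ∨ k % 3 = 1 ∨ k % 3 = 2 := by omega
    rcases h3 with h0 | h1 | h2
    · -- `k = 3m`: `(u q^{-m})^3 = 1`, so `u = q^m ∈ q^ℤ`
      exfalso
      obtain ⟨m, hm⟩ : ∃ m, k = 3 * m := ⟨k / 3, by omega⟩
      have hw3 : (u * q ^ (-m)) ^ 3 = 1 := by
        rw [mul_pow, e3, ← hk, ← zpow_add, show k + -m * 3 = 0 by omega, zpow_zero]
      have hw : ((u * q ^ (-m) : ℚ_[3]ˣ) : ℚ_[3]) = 1 := by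
        apply cube_eq_one_padic_three
        rw [← Units.val_pow_eq_pow_val, hw3, Units.val_one]
      have hu : u = q ^ m := by
        have h1 : u * q ^ (-m) = 1 := Units.val_eq_one.mp hw
        rw [zpow_neg] at h1
        exact (mul_inv_eq_one.mp h1)
      exact hnot (Subgroup.mem_zpowers_iff.mpr ⟨m, hu.symm⟩)
    · -- `k = 3m + 1`: `(u q^{-m})^3 = q`
      obtain ⟨m, hm⟩ : ∃ m, k = 3 * m + 1 := ⟨k / 3, by omega⟩
      refine ⟨u * q ^ (-m), ?_⟩
      rw [mul_pow, e3, ← hk, ← zpow_add, show k + -m * 3 = 1 by omega, zpow_one]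
    · -- `k = 3m + 2`: `(u² q^{-(2m+1)})^3 = q`
      obtain ⟨m, hm⟩ : ∃ m, k = 3 * m + 2 := ⟨k / 3, by omega⟩
      refine ⟨u ^ 2 * q ^ (-(2 * m + 1)), ?_⟩
      have hu6 : (u ^ 2) ^ (3 : ℕ) = q ^ (k * 2) := by
        rw [← pow_mul, show 2 * 3 = 3 * 2 by norm_num, pow_mul, ← hk, ← zpow_natCast (q ^ k) 2,
          ← zpow_mul]
        norm_num
      rw [mul_pow, e3, hu6, ← zpow_add, show k * 2 + -(2 * m + 1) * 3 = 1 by omega, zpow_one]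
  · rintro ⟨u, hu⟩
    refine ⟨QuotientGroup.mk u, ?_, ?_⟩
    · intro h1
      obtain ⟨k, hk⟩ := Subgroup.mem_zpowers_iff.mp ((QuotientGroup.eq_one_iff u).mp h1)
      -- `q = u^3 = q^{3k}`, so `q^{3k-1} = 1`, contradiction
      have h : q ^ (k * 3 - 1) = 1 := by
        rw [zpow_sub_one, zpow_mul, hk, zpow_ofNat, hu, mul_inv_cancel]
      have := zpow_eq_one_of_norm_lt_one hq _ h
      omega
    · rw [← QuotientGroup.mk_pow, hu]
      exact (QuotientGroup.eq_one_iff (q : ℚ_[3]ˣ)).mpr (Subgroup.mem_zpowers q)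

/-- Additive reading: in `Additive (ℚ₃^×/q^ℤ)` there is a non-zero element killed by `3` iff `q` is
a cube. [folklore] -/
theorem exists_torsion_three_additive_iff {q : ℚ_[3]ˣ} (hq : ‖(q : ℚ_[3])‖ < 1) :
    (∃ y : Additive (ℚ_[3]ˣ ⧸ Subgroup.zpowers q), y ≠ 0 ∧ 3 • y = 0) ↔
      ∃ u : ℚ_[3]ˣ, u ^ 3 = q := by
  rw [← exists_torsion_three_quotient_iff hq]
  constructor
  · rintro ⟨y, hy0, hy3⟩
    refine ⟨Additive.toMul y, fun h ↦ hy0 ?_, ?_⟩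
    · have h' := congrArg Additive.ofMul h
      rwa [ofMul_toMul, ofMul_one] at h'
    · rw [← toMul_nsmul, hy3, toMul_zero]
  · rintro ⟨x, hx1, hx3⟩
    refine ⟨Additive.ofMul x, fun h ↦ hx1 ?_, ?_⟩
    · have h' := congrArg Additive.toMul h
      rwa [toMul_ofMul, toMul_zero] at h'
    · rw [← ofMul_pow, hx3, ofMul_one]

end Quotient

/-! ### The local-torsion clause at `3` from the Tate parameter -/

section Curve

variable [Fact (Nat.Prime 3)] (W : WeierstrassCurve ℚ) [W.IsElliptic] [W.IsGloballyMinimal]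

omit [W.IsGloballyMinimal] in
/-- **Split multiplicative `3`: `E(ℚ₃)[3] ≠ 0` iff the Tate parameter is a cube.** For `E/ℚ`
(globally minimal `W`) with a Tate parameter datum `D` at `3` (so `3` is SPLIT multiplicative,
`q_E = D.q`, `0 < ‖q_E‖ < 1`, `j(q_E) = j(E)`): there is a non-zero `P ∈ E(ℚ₃)` with `3P = O` iff
`q_E = u³` for some `u ∈ ℚ₃`. Through Tate's uniformization `E(ℚ₃) ≅ ℚ₃^×/q_E^ℤ` (hypothesis `hT` =
ATAEC V.3.1(d) + V.5.3, the proposed fact `tateUniformization_points`) this is `exists_torsion_three_additive_iff`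
(`μ₃(ℚ₃) = 1`). CONDITIONAL on `hT`. [cite: SilvermanATAEC1994, Thm. V.3.1 (d) (PDF p. 395) and Thm. V.5.3 (PDF p. 407)] -/
theorem three_torsion_ne_zero_iff_isCube
    (hT : ∀ D : WeierstrassCurve.TateParameterData W 3,
      ∃ f : (W.baseChange ℚ_[3]).toAffine.Point →
          Additive (ℚ_[3]ˣ ⧸ Subgroup.zpowers (Units.mk0 D.q D.q_ne_zero)),
        Function.Bijective f ∧ ∀ P Q, f (P + Q) = f P + f Q)
    (D : WeierstrassCurve.TateParameterData W 3) :
    (∃ P : (W.baseChange ℚ_[3]).toAffine.Point, P ≠ 0 ∧ 3 • P = 0) ↔ ∃ u : ℚ_[3], u ^ 3 = D.q := by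
  obtain ⟨f, hbij, hadd⟩ := hT D
  have hq : ‖((Units.mk0 D.q D.q_ne_zero : ℚ_[3]ˣ) : ℚ_[3])‖ < 1 := by
    rw [Units.val_mk0]; exact D.norm_q_lt_one
  -- `f` is additive: `f 0 = 0`, `f (n • P) = n • f P`
  have hf0 : f 0 = 0 := by
    have h := hadd 0 0
    rw [add_zero] at h
    -- read in the multiplicative group `ℚ₃^×/q^ℤ`: `a = a * a` forces `a = 1`
    have hm : Additive.toMul (f 0) = Additive.toMul (f 0) * Additive.toMul (f 0) := by
      conv_lhs => rw [h]
      exact toMul_add _ _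
    have h1 : Additive.toMul (f 0) = 1 := by
      have h2 := congrArg (fun z ↦ (Additive.toMul (f 0))⁻¹ * z) hm
      simp only [inv_mul_cancel, inv_mul_cancel_left] at h2
      exact h2.symm
    calc f 0 = Additive.ofMul (Additive.toMul (f 0)) := (ofMul_toMul (f 0)).symm
      _ = Additive.ofMul 1 := by rw [h1]
      _ = 0 := ofMul_one
  have hfn : ∀ (n : ℕ) (P : (W.baseChange ℚ_[3]).toAffine.Point), f (n • P) = n • f P := by
    intro n P
    induction n with
    | zero => rw [zero_nsmul, zero_nsmul, hf0]
    | succ n ih => rw [succ_nsmul, succ_nsmul, hadd, ih]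
  -- transport through `f`
  have step : (∃ P : (W.baseChange ℚ_[3]).toAffine.Point, P ≠ 0 ∧ 3 • P = 0) ↔
      ∃ y : Additive (ℚ_[3]ˣ ⧸ Subgroup.zpowers (Units.mk0 D.q D.q_ne_zero)), y ≠ 0 ∧ 3 • y = 0 := by
    constructor
    · rintro ⟨P, hP0, hP3⟩
      refine ⟨f P, fun h ↦ hP0 (hbij.1 (h.trans hf0.symm)), ?_⟩
      rw [← hfn, hP3, hf0]
    · rintro ⟨y, hy0, hy3⟩
      obtain ⟨P, rfl⟩ := hbij.2 y
      refine ⟨P, fun h ↦ hy0 (by rw [h, hf0]), hbij.1 ?_⟩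
      rw [hfn, hy3, hf0]
  rw [step, exists_torsion_three_additive_iff hq]
  -- units versus field elements
  constructor
  · rintro ⟨u, hu⟩
    refine ⟨(u : ℚ_[3]), ?_⟩
    rw [← Units.val_pow_eq_pow_val, hu, Units.val_mk0]
  · rintro ⟨u, hu⟩
    have hu0 : u ≠ 0 := by
      rintro rfl
      rw [zero_pow (by norm_num)] at hu
      exact D.q_ne_zero hu.symm
    refine ⟨Units.mk0 u hu0, Units.val_injective ?_⟩
    rw [Units.val_pow_eq_pow_val, Units.val_mk0, hu, Units.val_mk0]

omit [W.IsGloballyMinimal] in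
/-- **The local-torsion clause of the A′-locus at a SPLIT `3` holds iff the Tate parameter is NOT a
cube**: `(∀ P ∈ E(ℚ₃), 3P = O → P = O) ⟺ ¬ ∃ u, u³ = q_E` — the second conjunct of
`X11.AprimeLocusAt W 3` (Castella's erratum Thm. A′ hypothesis "`E(ℚ_p)[p] = 0`") decided at the
pair by the cube class of `q_E`. CONDITIONAL on `hT` (Tate's uniformization of the points).
[cite: SilvermanATAEC1994, Thm. V.3.1 (d) (PDF p. 395) and Thm. V.5.3 (PDF p. 407)]
[cite: Castella2018Erratum, Thm. A′ (p. 1), hypotheses, and Remark (pp. 1–2)] -/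
theorem aprimeTorsionClause_three_iff_not_isCube
    (hT : ∀ D : WeierstrassCurve.TateParameterData W 3,
      ∃ f : (W.baseChange ℚ_[3]).toAffine.Point →
          Additive (ℚ_[3]ˣ ⧸ Subgroup.zpowers (Units.mk0 D.q D.q_ne_zero)),
        Function.Bijective f ∧ ∀ P Q, f (P + Q) = f P + f Q)
    (D : WeierstrassCurve.TateParameterData W 3) :
    (∀ P : (W.baseChange ℚ_[3]).toAffine.Point, 3 • P = 0 → P = 0) ↔ ¬ ∃ u : ℚ_[3], u ^ 3 = D.q := by
  rw [← three_torsion_ne_zero_iff_isCube W hT D]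
  constructor
  · rintro h ⟨P, hP0, hP3⟩
    exact hP0 (h P hP3)
  · intro h P hP3
    by_contra hP0
    exact h ⟨P, hP0, hP3⟩

/-- **A cube Tate parameter at `3` forces `3 ∣ v₃(Δ_min)`** (`ord₃ q_E = v₃(Δ_min(E))`, the tree
theorem `TateParameterData.valuation_q_eq_padicValInt_holds`; `ord₃ u³ = 3·ord₃ u`) — consistent
with the sibling's necessary condition `LocalTorsion.split_and_dvd_of_localTorsion_ne_zero`
(`E(ℚ₃)[3] ≠ 0 ⟹ split ∧ 3 ∣ v₃(Δ_min)`), here without the uniformization fact.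
[cite: SilvermanATAEC1994, IV.9 Remark 9.6 (PDF p. 355) and VI.4 Thm. 4.2 (PDF p. 430)] -/
theorem three_dvd_padicValInt_of_isCube (D : WeierstrassCurve.TateParameterData W 3)
    (h : ∃ u : ℚ_[3], u ^ 3 = D.q) :
    (3 : ℤ) ∣ padicValInt 3 W.minimalDiscriminantInt := by
  obtain ⟨u, hu⟩ := h
  have hu0 : u ≠ 0 := by
    rintro rfl
    rw [zero_pow (by norm_num)] at hu
    exact D.q_ne_zero hu.symm
  have hval : D.q.valuation = 3 * u.valuation := by
    rw [← hu, Padic.valuation_pow]; push_cast; ring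
  have hD : D.q.valuation = padicValInt 3 W.minimalDiscriminantInt :=
    WeierstrassCurve.TateParameterData.valuation_q_eq_padicValInt_holds D
  exact ⟨u.valuation, by rw [← hD, hval]⟩

/-- **At a multiplicative `3`, the local-torsion clause of the A′-locus is DECIDED by local data**:
it holds iff `3` is non-split, or `3` is split and the Tate parameter (which then exists: Tate's
theorem, tree theorem `nonempty_tateParameterData_iff_holds`) is not a cube in `ℚ₃`. The non-split
half is the sibling's `LocalTorsion.localTorsion_eq_zero_of_nonsplit` (`p ≥ 3`, no uniformization
needed); the split half is `aprimeTorsionClause_three_iff_not_isCube`. CONDITIONAL on `hT` (split half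
only). [cite: SilvermanATAEC1994, Thm. V.5.3 (PDF p. 407)]
[cite: SilvermanAEC2009, Thm VII.6.1] [cite: Castella2018Erratum, Thm. A′ (p. 1), hypotheses] -/
theorem aprimeTorsionClause_three_of_mult_iff
    (hT : ∀ D : WeierstrassCurve.TateParameterData W 3,
      ∃ f : (W.baseChange ℚ_[3]).toAffine.Point →
          Additive (ℚ_[3]ˣ ⧸ Subgroup.zpowers (Units.mk0 D.q D.q_ne_zero)),
        Function.Bijective f ∧ ∀ P Q, f (P + Q) = f P + f Q)
    (hmult : Mult W 3) :
    (∀ P : (W.baseChange ℚ_[3]).toAffine.Point, 3 • P = 0 → P = 0) ↔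
      (¬ W.HasSplitMultiplicativeReductionAtPrime 3 ∨
        ∃ D : WeierstrassCurve.TateParameterData W 3, ¬ ∃ u : ℚ_[3], u ^ 3 = D.q) := by
  constructor
  · intro h
    by_cases hs : W.HasSplitMultiplicativeReductionAtPrime 3
    · obtain ⟨D⟩ := (WeierstrassCurve.nonempty_tateParameterData_iff_holds W 3).mpr hs
      exact Or.inr ⟨D, (aprimeTorsionClause_three_iff_not_isCube W hT D).mp h⟩
    · exact Or.inl hs
  · rintro (hns | ⟨D, hD⟩)
    · exact LocalTorsion.localTorsion_eq_zero_of_nonsplit W 3 le_rfl hmult hns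
    · exact (aprimeTorsionClause_three_iff_not_isCube W hT D).mpr hD

/-- **The A′-locus at a SPLIT `3` from its `q`-witness and a NON-CUBE Tate parameter.** For `W/ℚ`
globally minimal elliptic, split multiplicative at `3` with Tate datum `D` such that `q_E` is not a
cube in `ℚ₃`, and a prime `q ≠ 3` of non-split multiplicative reduction with `3 ∤ v_q(Δ_min)`:
`X11.AprimeLocusAt W 3`. Complements the sibling's `X11.aprimeLocusAt_of_nonsplit` /
`X11.aprimeLocusAt_of_not_dvd` (there the clause needs no uniformization). CONDITIONAL on `hT`. [cite: Castella2018Erratum, Thm. A′ (p. 1), hypotheses]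
[cite: SilvermanATAEC1994, Thm. V.3.1 (d) (PDF p. 395) and Thm. V.5.3 (PDF p. 407)] -/
theorem X11.aprimeLocusAt_three_of_not_isCube
    (hT : ∀ D : WeierstrassCurve.TateParameterData W 3,
      ∃ f : (W.baseChange ℚ_[3]).toAffine.Point →
          Additive (ℚ_[3]ˣ ⧸ Subgroup.zpowers (Units.mk0 D.q D.q_ne_zero)),
        Function.Bijective f ∧ ∀ P Q, f (P + Q) = f P + f Q)
    (D : WeierstrassCurve.TateParameterData W 3) (hcube : ¬ ∃ u : ℚ_[3], u ^ 3 = D.q)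
    {q : ℕ} [Fact q.Prime] (hq3 : q ≠ 3) (hmq : Mult W q)
    (hnsq : ¬ W.HasSplitMultiplicativeReductionAtPrime q)
    (hvq : ¬ 3 ∣ padicValInt q W.minimalDiscriminantInt) : X11.AprimeLocusAt W 3 :=
  ⟨⟨q, ‹_›, hq3, hmq, hnsq, hvq⟩, (aprimeTorsionClause_three_iff_not_isCube W hT D).mpr hcube⟩

end Curve

end Summit.BirchSwinnertonDyer.Rank1Residual.X11b.Three

end
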